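import Mathlib.NumberTheory.NumberField.Discriminant.Different
import Mathlib.NumberTheory.RamificationInertia.Unramified
import HarnessLib

/-!
# A rational prime which is a square in a number field divides its discriminant

Topic `NumberTheory/NumberFields`.  Theorem-only file (no definition, no named fact).  If a
rational prime `p` is a square in a number field `K`, say `p = s²` with `s ∈ K`, then `s` is an
algebraic integer, and for any prime `Q` of `𝓞 K` above `p` we get `s ∈ Q`, so
`p 𝓞 K = (s)² ⊆ Q²`: the prime `Q` is ramified over `p` (`e(Q | p) ≠ 1`, Mathlib
`Ideal.ramificationIdx'_ne_one_iff`).  By Dedekind's discriminant theorem (Mathlib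
`NumberField.not_dvd_discr_iff_forall_mem`: `p ∤ d_K` iff `𝓞 K` is unramified at every prime
containing `p`, and `Ideal.ramificationIdx_eq_one` for unramified primes) this forces `p ∣ d_K`.
Equivalently: if `p ∤ d_K` then `√p ∉ K`; the case `p = 5` is the form in which the hypothesis
"`√5 ∉ K`" of automorphy lifting theorems over totally real fields is usually checked.

* `dvd_discr_of_isSquare_natCast` — `IsSquare (p : K) → p ∣ discr K`;
* `not_isSquare_natCast_of_not_dvd_discr` — the contrapositive;
* `not_isSquare_five_of_not_dvd_discr` — the case `p = 5`.

Standard (e.g. Neukirch, *Algebraic Number Theory*, Ch. III (2.6), (2.12): a prime ramifies iff it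
divides the discriminant); no single source, tagged folklore.
-/

open NumberField Ideal

namespace Literature.NumberTheory.NumberFields

/-- **A rational prime which is a square in `K` divides `d_K`.**  If `p = s²` with `s ∈ K` then
`s ∈ 𝓞 K`, any prime `Q ∋ p` of `𝓞 K` contains `s`, so `p 𝓞 K ⊆ Q²` and `Q` is ramified over `p`;
by Dedekind's discriminant theorem `p ∣ d_K`. [folklore] -/
theorem dvd_discr_of_isSquare_natCast (K : Type*) [Field K] [NumberField K] {p : ℕ}
    (hp : p.Prime) (h : IsSquare ((p : ℕ) : K)) : (p : ℤ) ∣ NumberField.discr K := by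
  classical
  obtain ⟨s, hs⟩ := h
  have hpZ : Prime (p : ℤ) := Nat.prime_iff_prime_int.mp hp
  -- `s` is an algebraic integer (`s² = p`), say `s = t ∈ 𝓞 K`, and `t² = p` in `𝓞 K`
  have hsint : IsIntegral ℤ s := by
    refine IsIntegral.of_pow two_pos ?_
    have hpint := isIntegral_algebraMap (R := ℤ) (A := K) (x := (p : ℤ))
    rwa [map_natCast, hs, ← sq] at hpint
  obtain ⟨t, ht⟩ := (IsIntegralClosure.isIntegral_iff (A := 𝓞 K)).mp hsint
  have htt : t * t = (p : 𝓞 K) := by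
    apply IsIntegralClosure.algebraMap_injective (𝓞 K) ℤ K
    rw [map_mul, map_natCast, ht]
    exact hs.symm
  -- a prime `Q` of `𝓞 K` above `p`; it contains `t`, so `p 𝓞 K ⊆ Q²`
  have hp0 : Ideal.span {(p : ℤ)} ≠ ⊥ := by
    rw [Ne, Ideal.span_singleton_eq_bot]
    exact hpZ.ne_zero
  haveI hpmax : (Ideal.span {(p : ℤ)}).IsMaximal :=
    ((Ideal.span_singleton_prime hpZ.ne_zero).mpr hpZ).isMaximal hp0
  obtain ⟨Q, hQmax, hQover⟩ :=
    Ideal.exists_maximal_ideal_liesOver_of_isIntegral (S := 𝓞 K) (Ideal.span {(p : ℤ)})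
  haveI := hQmax.isPrime
  have hpQ : (p : 𝓞 K) ∈ Q := by
    have h1 : (p : ℤ) ∈ Ideal.span {(p : ℤ)} := Ideal.mem_span_singleton_self _
    have h2 := (Ideal.mem_of_liesOver Q (Ideal.span {(p : ℤ)}) (p : ℤ)).mp h1
    rwa [map_natCast] at h2
  have htQ : t ∈ Q := by
    have h2 : t * t ∈ Q := by rw [htt]; exact hpQ
    exact (Ideal.IsPrime.mem_or_mem inferInstance h2).elim id id
  have hle2 : (Ideal.span {(p : ℤ)}).map (algebraMap ℤ (𝓞 K)) ≤ Q ^ 2 := by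
    rw [Ideal.map_span, Set.image_singleton, map_natCast, Ideal.span_le,
      Set.singleton_subset_iff, SetLike.mem_coe, ← htt, sq]
    exact Ideal.mul_mem_mul htQ htQ
  have hle1 : (Ideal.span {(p : ℤ)}).map (algebraMap ℤ (𝓞 K)) ≤ Q :=
    hle2.trans (Ideal.pow_le_self two_ne_zero)
  -- hence `e(Q | p) ≠ 1`
  have hne : Ideal.ramificationIdx' (Ideal.span {(p : ℤ)}) Q ≠ 1 :=
    (Ideal.ramificationIdx'_ne_one_iff hle1).mpr hle2
  -- but `p ∤ d_K` would make `Q` unramified over `ℤ`, `e(Q | p) = 1`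
  by_contra hnd
  haveI hunr : Algebra.IsUnramifiedAt ℤ Q :=
    (NumberField.not_dvd_discr_iff_forall_mem K (𝓞 K) hpZ).mp hnd Q inferInstance
      (by exact_mod_cast hpQ)
  have h1 : Q.ramificationIdx ℤ = 1 := Ideal.ramificationIdx_eq_one Q ℤ
  rw [← Ideal.ramificationIdx'_eq_ramificationIdx (Ideal.span {(p : ℤ)}) Q hp0] at h1
  exact hne h1

/-- **If `p ∤ d_K` then `p` is not a square in `K`** (`√p ∉ K` for a prime `p` unramified in
`K`): the contrapositive of `dvd_discr_of_isSquare_natCast`. [folklore] -/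
theorem not_isSquare_natCast_of_not_dvd_discr (K : Type*) [Field K] [NumberField K] {p : ℕ}
    (hp : p.Prime) (h : ¬ ((p : ℤ) ∣ NumberField.discr K)) : ¬ IsSquare ((p : ℕ) : K) :=
  fun hsq => h (dvd_discr_of_isSquare_natCast K hp hsq)

/-- **If `5 ∤ d_K` then `√5 ∉ K`**: the case `p = 5` of
`not_isSquare_natCast_of_not_dvd_discr`, in the numeral form `¬ IsSquare (5 : K)`. [folklore] -/
theorem not_isSquare_five_of_not_dvd_discr (K : Type*) [Field K] [NumberField K]
    (h : ¬ ((5 : ℤ) ∣ NumberField.discr K)) : ¬ IsSquare (5 : K) := by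
  have h5 := not_isSquare_natCast_of_not_dvd_discr K Nat.prime_five (by exact_mod_cast h)
  rwa [Nat.cast_ofNat] at h5

end Literature.NumberTheory.NumberFields
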